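import Mathlib.Analysis.SpecialFunctions.Integrals.Basic
import Mathlib.MeasureTheory.Integral.IntervalIntegral.Basic
import HarnessLib

/-!
# Random Fourier features: averaging the random phase reproduces the shift-invariant kernel

Sweke, Recio-Armengol, Jerbi, Gil-Fuster, Fuller, Eisert, Meyer, *Potential and limitations of random
Fourier features for dequantizing quantum machine learning*, Quantum **9**, 1640 (2025) = arXiv:2309.11647,
§2.3 eq. (13) (the method of Rahimi–Recht, *Random features for large-scale kernel machines*, NIPS 2007
[RR07]): for a shift-invariant kernel `K(x − x') = ∫ cos⟨ω, x − x'⟩ q(ω) dω`,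
"`K(x − x') = (1/2π) ∫_ω ∫_{γ ∈ [0,2π)} √2 cos(⟨ω, x⟩ + γ) · √2 cos(⟨ω, x'⟩ + γ) q(ω) dω dγ
 =: ∫ ψ(x, ν) ψ(x', ν) dπ(ν)`, with `ψ(x, ν) := √2 cos(⟨ω, x⟩ + γ)` and `π = q × μ` where `μ` is the
uniform measure over `[0, 2π)`".

Instance-level adjudication context (lane pub-qadeq): RFF regression on the integer frequency spectrum of a
PQC model (sibling files `DataEncodingSpectrum.lean`, `QuantumKernelMethods.lean`) is the classical surrogate
against which "variational QML" and "quantum kitchen sinks" claims are dequantized in print (Landman et al.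
ICLR 2023; Sweke et al. 2025).  Nothing here is a statement about BQP vs BPP.

What is formalised (all PROVED; real phases `a = ⟨ω, x⟩`, `c = ⟨ω, x'⟩`, so that `a − c = ⟨ω, x − x'⟩`):
* (private) `two_mul_cos_mul_cos` — the product-to-sum step `2 cos(a+γ) cos(c+γ) = cos(a − c) + cos(a + c + 2γ)`;
* (private) `integral_cos_add_two_mul` — the oscillating term averages to zero over a period,
  `∫_{0}^{2π} cos(s + 2γ) dγ = 0`;
* `integral_rffFeature_mul` — the phase average of eq. (13):
  `∫_{0}^{2π} ψ_γ(a) ψ_γ(c) dγ = 2π cos(a − c)` for `ψ_γ(t) = √2 cos(t + γ)`, and the normalised form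
  `rff_phase_average` : `(1/(2π)) ∫_{0}^{2π} ψ_γ(a) ψ_γ(c) dγ = cos(a − c)`;
* `rff_discrete_spectrum` — the same identity summed against finitely many frequencies with weights
  `q` (the discrete / integer-spectrum case used for PQC surrogates, §2.4–§3 of the paper):
  `Σ_ω q_ω cos(a_ω − c_ω) = (1/(2π)) ∫_{0}^{2π} Σ_ω q_ω ψ_γ(a_ω) ψ_γ(c_ω) dγ`.
Deliberately NOT here: Bochner's theorem / the `ω`-integral against a general probability measure `q`, the
concentration bound of [RR07] (Claim 1), and any sample-complexity statement of the paper.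
-/

namespace Literature.Computability.QuantumComplexity.RandomFourierFeatures

open Real MeasureTheory intervalIntegral
open scoped BigOperators

noncomputable section

/-- The random Fourier feature with phase `γ`, evaluated at the projected input `t = ⟨ω, x⟩`:
`ψ_γ(t) = √2 cos(t + γ)`. [cite: SwekeEtAl2025RFF, §2.3 eq. (13)] -/
def rffFeature (γ t : ℝ) : ℝ := Real.sqrt 2 * Real.cos (t + γ)

/-- Product-to-sum: `2 cos(a+γ) cos(c+γ) = cos(a − c) + cos(a + c + 2γ)`. [folklore] -/
private theorem two_mul_cos_mul_cos (a c γ : ℝ) :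
    2 * Real.cos (a + γ) * Real.cos (c + γ) = Real.cos (a - c) + Real.cos (a + c + 2 * γ) := by
  have key : ∀ A B : ℝ, 2 * Real.cos A * Real.cos B = Real.cos (A - B) + Real.cos (A + B) := by
    intro A B
    rw [Real.cos_sub, Real.cos_add]
    ring
  have h := key (a + γ) (c + γ)
  rwa [show a + γ - (c + γ) = a - c by ring, show a + γ + (c + γ) = a + c + 2 * γ by ring] at h

/-- `ψ_γ` is continuous in the phase (plumbing for the interval integrals). [folklore] -/
private theorem continuous_rffFeature (t : ℝ) : Continuous fun γ => rffFeature γ t := by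
  unfold rffFeature
  fun_prop

/-- `ψ_γ(a) ψ_γ(c) = cos(a − c) + cos(a + c + 2γ)`. [cite: SwekeEtAl2025RFF, §2.3 eq. (13)] -/
theorem rffFeature_mul (γ a c : ℝ) :
    rffFeature γ a * rffFeature γ c = Real.cos (a - c) + Real.cos (a + c + 2 * γ) := by
  unfold rffFeature
  have hs : Real.sqrt 2 * Real.sqrt 2 = 2 := Real.mul_self_sqrt (by norm_num)
  calc Real.sqrt 2 * Real.cos (a + γ) * (Real.sqrt 2 * Real.cos (c + γ))
      = (Real.sqrt 2 * Real.sqrt 2) * Real.cos (a + γ) * Real.cos (c + γ) := by ring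
    _ = 2 * Real.cos (a + γ) * Real.cos (c + γ) := by rw [hs]
    _ = _ := two_mul_cos_mul_cos a c γ

/-- The oscillating term averages to zero over one period of the phase:
`∫_{0}^{2π} cos(s + 2γ) dγ = 0`. [folklore] -/
private theorem integral_cos_add_two_mul (s : ℝ) : ∫ γ in (0 : ℝ)..(2 * π), Real.cos (s + 2 * γ) = 0 := by
  have h := intervalIntegral.integral_comp_mul_add (a := (0 : ℝ)) (b := 2 * π)
    (fun u => Real.cos u) (two_ne_zero) s
  -- `∫ cos(2γ + s) dγ = 2⁻¹ • ∫_{s}^{4π + s} cos`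
  have h' : ∫ γ in (0 : ℝ)..(2 * π), Real.cos (s + 2 * γ)
      = (2 : ℝ)⁻¹ • ∫ u in (2 * 0 + s)..(2 * (2 * π) + s), Real.cos u := by
    rw [← h]
    congr 1
    funext γ
    ring_nf
  rw [h', integral_cos]
  have hp : Real.sin (2 * (2 * π) + s) = Real.sin (2 * 0 + s) := by
    rw [show 2 * (2 * π) + s = (2 * 0 + s) + 2 * π + 2 * π by ring, Real.sin_add_two_pi, Real.sin_add_two_pi]
  rw [hp, sub_self, smul_zero]

/-- **The phase average reproduces the kernel** (Sweke et al. eq. (13), inner integral; Rahimi–Recht 2007):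
`∫_{0}^{2π} ψ_γ(a) ψ_γ(c) dγ = 2π · cos(a − c)`, where for `a = ⟨ω, x⟩`, `c = ⟨ω, x'⟩` the right-hand side is
`2π cos⟨ω, x − x'⟩`. [cite: SwekeEtAl2025RFF, §2.3 eq. (13)] -/
theorem integral_rffFeature_mul (a c : ℝ) :
    ∫ γ in (0 : ℝ)..(2 * π), rffFeature γ a * rffFeature γ c = 2 * π * Real.cos (a - c) := by
  simp_rw [rffFeature_mul]
  rw [intervalIntegral.integral_add (by
        exact (continuous_const).intervalIntegrable _ _) (by
        exact (Real.continuous_cos.comp (continuous_const.add (continuous_const.mul continuous_id))).intervalIntegrable _ _),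
    intervalIntegral.integral_const, integral_cos_add_two_mul]
  simp

/-- Normalised form of eq. (13): averaging over the uniform phase `γ ∈ [0, 2π)` gives exactly the
shift-invariant kernel value, `(1/2π) ∫_{0}^{2π} ψ_γ(a) ψ_γ(c) dγ = cos(a − c)`. [cite: SwekeEtAl2025RFF, §2.3 eq. (13)] -/
theorem rff_phase_average (a c : ℝ) :
    (1 / (2 * π)) * ∫ γ in (0 : ℝ)..(2 * π), rffFeature γ a * rffFeature γ c = Real.cos (a - c) := by
  rw [integral_rffFeature_mul]
  have hπ : (2 * π) ≠ 0 := by positivity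
  field_simp

/-- Discrete (finitely supported) frequency measure `q` — the integer-spectrum case of PQC surrogates
(§2.4–§3): `Σ_ω q_ω cos(a_ω − c_ω) = (1/2π) ∫_{0}^{2π} Σ_ω q_ω ψ_γ(a_ω) ψ_γ(c_ω) dγ`, i.e. the finite
mixture kernel is the phase average of the weighted random-feature products. [cite: SwekeEtAl2025RFF, §2.3 eq. (13), §2.4] -/
theorem rff_discrete_spectrum {ι : Type*} (Ω : Finset ι) (q a c : ι → ℝ) :
    ∑ ω ∈ Ω, q ω * Real.cos (a ω - c ω)
      = (1 / (2 * π)) * ∫ γ in (0 : ℝ)..(2 * π), ∑ ω ∈ Ω, q ω * (rffFeature γ (a ω) * rffFeature γ (c ω)) := by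
  rw [intervalIntegral.integral_finsetSum (fun ω _ => ?_)]
  · rw [Finset.mul_sum]
    refine Finset.sum_congr rfl fun ω _ => ?_
    rw [intervalIntegral.integral_const_mul, ← mul_assoc, mul_comm (1 / (2 * π)) (q ω), mul_assoc,
      rff_phase_average]
  · exact (continuous_const.mul ((continuous_rffFeature _).mul (continuous_rffFeature _))).intervalIntegrable _ _

end

end Literature.Computability.QuantumComplexity.RandomFourierFeatures
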